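import Summits.SmoothPoincare4.SmoothPoincare4.Theses.CongruenceShadows
import Mathlib.GroupTheory.SpecificGroups.Cyclic
import Mathlib.Data.ZMod.QuotientGroup

/-!
# Line `fine-closure-collapse` — crux `CongruenceShadows.HeegaardHandlebodyCongruenceClosed`
(stmt-SmoothPoincare4-14596, rank 6 of route `CongruenceShadows`) — skeleton, crux-plan gen 2

Skeleton for the idea card `Ideas/fine-closure-collapse.md` (ideator 1, round 1; TRIAGE-r1-1/2/3:
pass ×3, "merge with pair-rigidity-retraction ≈ profinite-pair-rigidity: same three-slot line
ghosts / pairs / relative gate").  Gen 2 is written AFTER the lead prover picked the sibling line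
`pair-rigidity-retraction` (PICKED.md; this line ranked second) and registered its reshaped
skeleton (sha `01bbf8c2e032`).  It therefore (i) keeps gen 1's proved lever and certificates,
(ii) ALIGNS its registered-stub statements with the live build — `stub_profiniteFreenessDetection`,
`stub_limitsSimplyConnected` have the lead's statements verbatim (up to the abbreviations `S`, `N`,
`PairQuot`, `FineClosure`), and `FineApprox` (= the lead's `stub_fineApprox`) is registered here
split by genus range (`stub_fineApproxGenusThree` ∧ `stub_fineApproxPos`, `fineApprox_iff`) —
so every stub proof landed for either line serves both, and (iii) PROVES the two "provable now"
pieces: the genus-3 cyclic collapse C₀ and the level transport of finite quotients B₁, the latter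
ALSO in the exact form of the lead's registered `stub_pairShadowFiniteQuotients`
(`pairShadowFiniteQuotients_holds`, harvestable as is).  This skeleton is deliberately NOT
registered on the crux item (one active skeleton per crux: registering would expire the lead's
stubs); its audit (`#h21_check_skeleton`, ok, theorem `HeegaardHandlebodyCongruenceClosed_of`) was run
in the planner's scratch check and is attached as evidence.

Read the crux per `ρ ∈ Aut S`, `S = S_{3+3m}`, `N = s4Kernels.stabilizeIter m`:
`FineClosure m ρ` (`ρ` is congruent, modulo every characteristic finite-index `M ≤ S`, to a product
`x ∘ c`, `x ∈ Stab N₀ ∩ Stab N₁ =: P`, `c ∈ Stab N₂ =: Q`) ⟹ `InPQ m ρ` (`ρ ∈ P·Q`); `crux_iff` is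
`Iff.rfl`.  The line studies the TWISTED TRIPLE `T_ρ = (N₀, N₁, ρN₂)` (`twisted m ρ`) and its
triple join `N₀ ⊔ N₁ ⊔ ρN₂` (`tripleJoin m ρ`, the kernel of `S ↠ G_ρ := π₁` of the glued 4-manifold).

## The lever (PROVED): characteristic cofinality collapses the triple quotient level-wise

`tripleJoin_sup_eq_top_of_fineClosure`: `FineClosure m ρ → (N₀ ⊔ N₁ ⊔ ρN₂) ⊔ M = ⊤` for every
characteristic finite-index `M` (the `x` supplied at level `M` preserves `M`).  Likewise the two
PAIRS `(N_i, ρN₂)`, `i = 0, 1`, are shadow-standard at every level (`pairShadow_of_fineClosure`) and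
all three shadows of `T_ρ` are standard (`shadow_of_fineClosure`, witness `ψ := x_M`).

## Proved statements (sorry-free) and REGISTERED STUBS (sorried)

* A  `profiniteCollapse_holds` (PROVED): `FineClosure ⟹ Ĝ_ρ = 1` (`ProfinitelyTrivial`: every hom
  to a finite group killing `N₀, N₁, ρN₂` is trivial) — level collapse at the characteristic core
  `⨅ φ : S →* Q, ker φ` (characteristic, finite index since `S →* Q` is finite).
* B₁ `pairFiniteQuotients_holds` / `pairShadowFiniteQuotients_holds` (PROVED, gen 2): LEVEL
  TRANSPORT — if the pair `(N_i, θN₂)` is shadow-standard at every characteristic finite-index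
  level, then `S/⟪N_i, θN₂⟫` has exactly the finite quotients of the standard pair quotient
  `S/⟪N_i, N₂⟫ ≅ F_{m+1}` (a surjection `S ↠ Q` killing one pair is carried to one killing the other
  by the level automorphism at the characteristic core of `Q`).  The second form is the live
  build's registered `stub_pairShadowFiniteQuotients`, verbatim.
* B₂ `stub_profiniteFreenessDetection` (REGISTERED; a THEOREM IN PRINT, XL to vendor; the live
  build's stub of the same name, verbatim): PROFINITE DETECTION OF FREENESS — if `S/⟪N_i, θN₂⟫`
  (`= π₁` of the closed orientable 3-manifold `Y_θ = H_i ∪_Σ H_{θN₂}`, `θN₂` a handlebody kernel by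
  Dehn–Nielsen–Baer) has the finite quotients of `F_{m+1}`, it IS free of rank `m+1`: same finite
  quotients of f.g. groups ⟹ `π̂₁(Y_θ) ≅ F̂_{m+1}` (Dixon–Formanek–Poland–Ribes 1982) ⟹
  `Y_θ ≅ #^{m+1}(S¹×S²)` (Wilton–Zalesskii 2019 Thm 1, arXiv:1703.03701, with Perelman and residual
  finiteness of 3-manifold groups) ⟹ `π₁(Y_θ) ≅ F_{m+1}`.  No Waldhausen, no Dehn–Nielsen in the
  conclusion: the Waldhausen half of pair rigidity is the route's existing item `WaldhausenPairs`
  (stmt-14592), needed only on the exit through 14595 (`fineApprox_of_shadowApproximation`).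
* C₀ `noGhostsGenusThree_holds` (PROVED, gen 2; the `m = 0` dividend): at genus 3 the twisted triple
  quotient is a quotient of `S₃/(N₀ ⊔ N₁) = ⟨b₀⟩`, hence cyclic; cyclic and profinitely trivial ⟹
  trivial (`ℤ/p`-quotient of `Multiplicative (ZMod (Nat.card G_ρ))`).
* C₊ `stub_limitsSimplyConnected` (REGISTERED, OPEN; the crux's private conjunct "no fine ghosts" =
  LimitsSimplyConnected = KervaireExclusion, genus `≥ 6`; the live build's stub verbatim): in the
  fine closure the (profinitely trivial, by A) triple quotient is trivial.  NECESSARY for the crux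
  (`limitsSimplyConnectedPos_of_crux`); threatened only by a Waldhausen-normalised balanced trisection
  of Kervaire's homology 4-sphere on Higman's group lying in the fine closure (cdisprove's test).
* D₀ `stub_fineApproxGenusThree` (REGISTERED, OPEN; the line's FIRST TARGET per TRIAGE-r1-2/3): a
  genuine `(3;1,1,1)` group trisection of `{1}` of the form `T_ρ = (N₀, N₁, ρN₂)` with `ρ` in the fine
  closure is standard (`Iso N T_ρ`, equivalently `ρ ∈ P·Q`, `inPQ_of_iso`).  Given B₂ this IS the
  crux at genus 3 (`cruxZero_iff_fineApproxGenusThree`, proved: C₀ and B₁ being theorems, no ghost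
  or transport hypothesis remains at `m = 0`).
* D₊ `stub_fineApproxPos` (REGISTERED, OPEN, hardest: SPC4_g ∧ balanced-Waldhausen_g strength on
  the fine locus, genus `≥ 6`).  D := D₀ ∧ D₊ (`fineApprox_iff`) is the live build's `stub_fineApprox`
  verbatim and is the sibling crux `ShadowApproximation` (stmt-14595) ∧ `WaldhausenPairs`
  (stmt-14592) on a smaller locus: PROVED `fineApprox_of_shadowApproximation :
  ShadowApproximation → WaldhausenPairs → FineApprox`.
* Composition `composition : B₂ → C₊ → D₀ → D₊ → (∀ m ρ, FineClosure m ρ → InPQ m ρ)` (sorry-free,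
  axioms propext / Classical.choice / Quot.sound; A, B₁, C₀ enter as theorems), and THE skeleton
  theorem `HeegaardHandlebodyCongruenceClosed_of : HeegaardHandlebodyCongruenceClosed` — the only
  theorem of the file concluding the crux BY NAME — which feeds `composition` the four registered
  stubs.  Genus 3 alone: `cruxZero_of : B₂ at m = 0 → D₀ → crux at m = 0`.
* Certificates (sorry-free): `crux_iff`, non-vacuity (`fineClosure_of_inPQ`, `inPQ_refl`),
  necessity (`limitsSimplyConnectedPos_of_crux`, `fineApproxGenusThree_of_crux`,
  `fineApproxPos_of_crux`: C₊, D₀, D₊ are implied by the crux, so a refutation of any of them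
  refutes the crux itself — route kill criterion "drop rank 6 / restate with `N₀ ⊔ N₁ ⊔ ρN₂ = ⊤`").

## Disproof.lean (cdisprove cycle 1, read 2026-08-16) — what the stub set honours

No `_false_without_` theorem is recorded yet; the file's LOAD-BEARING finding is
`cruxWithoutFiniteIndex_holds` (all content sits in the finite-index levels: every statement here
quantifies over characteristic FINITE-INDEX `M`, and A/B₁ use finiteness essentially — `charCore`)
and its refuted strengthenings are `not_conclusionUniversal` (`P ≠ Aut S₃`), `not_singleLevelSuffices` /
`not_levelTwoSuffices` (ONE level, even `M₂ = ker(S₃ → H₁(S₃;𝔽₂))`, never suffices: `ρ₁ = T_c²`).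
B₂ and D₀/D₊ conclude from ALL-level data only, none asserts gate membership unconditionally — so no
stub is an instance of a refuted strengthening.  Landed Negative lemmas of the SIBLING cruxes are
honoured too: `Theorems/ShadowApproximation/Negative/ShadowsOnlyFalse.lean`
(`shadowApproximation_false_without_isGroupTrisection`: the junk triple `(N₀, N₁, N₂ ⊓ ker θ)` has all
shadows standard but is not `Iso` to `N`) — in B₂ and D the third slot is `ρN₂`, the image of the
handlebody kernel under an AUTOMORPHISM (`S/ρN₂ ≅ F_g` free), and D keeps `IsGroupTrisection` as a
hypothesis; `…/Negative/UnitTwist.lean` (`delta_level`: the unit twist `δ` is a symmetry of all three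
level-5 shadows of `N`) — no statement here passes from shadow data to product data at ONE level:
B₁/B₂ conclude from all levels through the pair 3-manifold, D keeps the product datum `FineClosure`;
`Theorems/WaldhausenPairs/Negative/PairTransferFalse.lean` (`not_pairTransfer`),
`…/StandardPairSymmetries.lean` (`not_pairsDetermineThird`), `…/LoadBearing.lean`
(`waldhausenPairs_false_without_pairFree/_freeQuotient`) — no stub transfers a stabiliser between
kernels or lets two pairs determine the third (D keeps `FineClosure` AND `IsGroupTrisection`), and B₂
is a statement about the pair quotient of a pair of full-rank handlebody kernels, as those analyses
require.  No Negative lemma has landed for 14596 itself.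
-/

set_option linter.dupNamespace false

noncomputable section

namespace Summit.SmoothPoincare4.SmoothPoincare4.Cruxes.HeegaardHandlebodyCongruenceClosed.FineClosureCollapse

open Literature.Topology.FourManifolds Subgroup
open Summit.SmoothPoincare4.SmoothPoincare4.Theses.CongruenceShadows
  (HeegaardHandlebodyCongruenceClosed ShadowApproximation WaldhausenPairs)

/-! ## Vocabulary (local abbreviations over `GroupTrisections.lean`; no new Literature notions) -/

/-- The surface group at the route's genus, `S m = S_{3+3m} = π₁(Σ_{3+3m})`. -/
abbrev S (m : ℕ) : Type := SurfaceGroup (3 + 3 * m)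

/-- The standard stabilised `S⁴` kernel triple `N m = (N₀, N₁, N₂)` of genus `3 + 3m`. -/
abbrev N (m : ℕ) : TrisectionKernels (3 + 3 * m) := s4Kernels.stabilizeIter m

/-- HYPOTHESIS of the crux for one `ρ` (the FINE congruence closure of `P·Q`): modulo every
characteristic finite-index `M`, `ρ ≡ x ∘ c` with `x ∈ Stab N₀ ∩ Stab N₁` and `c ∈ Stab N₂`.
(An `abbrev`, so that stub signatures unfold to the live build's spelled-out form.) -/
abbrev FineClosure (m : ℕ) (ρ : S m ≃* S m) : Prop :=
  ∀ M : Subgroup (S m), M.Characteristic → M.FiniteIndex →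
    ∃ x c : S m ≃* S m, (N m 0).map x.toMonoidHom = N m 0 ∧ (N m 1).map x.toMonoidHom = N m 1 ∧
      (N m 2).map c.toMonoidHom = N m 2 ∧ ∀ s, ρ s * (x (c s))⁻¹ ∈ M

/-- CONCLUSION of the crux for one `ρ`: `ρ ∈ P·Q`, i.e. `ρ = x ∘ c`. -/
abbrev InPQ (m : ℕ) (ρ : S m ≃* S m) : Prop :=
  ∃ x c : S m ≃* S m, (N m 0).map x.toMonoidHom = N m 0 ∧ (N m 1).map x.toMonoidHom = N m 1 ∧
    (N m 2).map c.toMonoidHom = N m 2 ∧ ∀ s, ρ s = x (c s)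

/-- Read-back: the crux is literally `∀ m ρ, FineClosure m ρ → InPQ m ρ`. -/
theorem crux_iff : HeegaardHandlebodyCongruenceClosed ↔ ∀ (m : ℕ) (ρ : S m ≃* S m), FineClosure m ρ → InPQ m ρ :=
  Iff.rfl

/-- The twisted triple `T_ρ = (N₀, N₁, ρN₂)`. -/
abbrev twisted (m : ℕ) (ρ : S m ≃* S m) : TrisectionKernels (3 + 3 * m) :=
  ![N m 0, N m 1, (N m 2).map ρ.toMonoidHom]

/-- The triple join `N₀ ⊔ N₁ ⊔ ρN₂` (`= ⟪T_ρ⟫`, all three being normal): the kernel of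
`S ↠ G_ρ`, the fundamental group of the 4-manifold glued from `T_ρ`. -/
abbrev tripleJoin (m : ℕ) (ρ : S m ≃* S m) : Subgroup (S m) :=
  N m 0 ⊔ N m 1 ⊔ (N m 2).map ρ.toMonoidHom

/-- The TWISTED PAIR QUOTIENT `S ⧸ ⟪N_i, θN₂⟫ = π₁(H_i ∪_Σ H_{θN₂})` (`= (twisted m θ).pairQuotient i 2`
for `i = 0, 1`). -/
abbrev PairQuot (m : ℕ) (i : Fin 3) (θ : S m ≃* S m) : Type :=
  S m ⧸ normalClosure ((N m i : Set (S m)) ∪ ((N m 2).map θ.toMonoidHom : Subgroup (S m)))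

/-- `G` HAS THE FINITE QUOTIENTS OF `F_{m+1}`. -/
abbrev HasFiniteQuotientsOfFree (m : ℕ) (G : Type) [Group G] : Prop :=
  ∀ (Q : Type) [Group Q] [Finite Q],
    (∃ f : G →* Q, Function.Surjective f) ↔ (∃ f : FreeGroup (Fin (m + 1)) →* Q, Function.Surjective f)

/-- `G_ρ = S ⧸ tripleJoin m ρ` is PROFINITELY TRIVIAL: every homomorphism from `S` to a finite
group that kills `N₀`, `N₁` and `ρN₂` is trivial. -/
def ProfinitelyTrivial (m : ℕ) (ρ : S m ≃* S m) : Prop :=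
  ∀ (G : Type) [Group G] [Finite G] (f : S m →* G), tripleJoin m ρ ≤ f.ker → ∀ s, f s = 1

/-- The PAIR `(N_i, θN₂)` is SHADOW-STANDARD at every characteristic finite-index level: one level
automorphism carries `(N_i M, N₂ M)` onto `(N_i M, θN₂ M)` (the weakest pair datum; implied by the
fine datum, `pairShadow_of_fineClosure`, and importable by the sibling crux `ShadowApproximation`). -/
abbrev PairShadowStandard (m : ℕ) (i : Fin 3) (θ : S m ≃* S m) : Prop :=
  ∀ M : Subgroup (S m), M.Characteristic → M.FiniteIndex →
    ∃ a : S m ≃* S m, (N m i ⊔ M).map a.toMonoidHom = N m i ⊔ M ∧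
      (N m 2 ⊔ M).map a.toMonoidHom = (N m 2).map θ.toMonoidHom ⊔ M

/-- The (finite) group `Q` is a QUOTIENT OF `S ⧸ A`: some surjection `S ↠ Q` kills `A`. -/
def IsQuotientOver {m : ℕ} (A : Subgroup (S m)) (Q : Type) [Group Q] : Prop :=
  ∃ f : S m →* Q, Function.Surjective f ∧ A ≤ f.ker

/-! ## Statements: proved pieces (A, B₁, C₀) and registered stubs (B₂, C₊, D₀, D₊) -/

/-- Statement A, PROFINITE COLLAPSE (PROVED below, `profiniteCollapse_holds`).  In the fine closure
the triple quotient `G_ρ` has no non-trivial finite quotient. -/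
def ProfiniteCollapse : Prop :=
  ∀ (m : ℕ) (ρ : S m ≃* S m), FineClosure m ρ → ProfinitelyTrivial m ρ

/-- Statement B₁, LEVEL TRANSPORT OF FINITE QUOTIENTS, engine form (PROVED below,
`pairFiniteQuotients_holds`): a pair `(N_i, θN₂)` that is shadow-standard at every characteristic
finite-index level has the same finite quotients over `S` as the standard pair `(N_i, N₂)`. -/
def PairFiniteQuotients : Prop :=
  ∀ (m : ℕ) (i : Fin 3), i ≠ 2 → ∀ θ : S m ≃* S m, PairShadowStandard m i θ →
    ∀ (Q : Type) [Group Q] [Finite Q],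
      IsQuotientOver (N m i ⊔ (N m 2).map θ.toMonoidHom) Q ↔ IsQuotientOver (N m i ⊔ N m 2) Q

/-- Statement B₁ in the live build's form (PROVED below, `pairShadowFiniteQuotients_holds`; this is
the registered `stub_pairShadowFiniteQuotients` of the lead's skeleton, verbatim up to abbreviations):
the twisted pair quotient has the finite quotients of `F_{m+1}`. -/
def PairShadowFiniteQuotients : Prop :=
  ∀ (m : ℕ) (i : Fin 3), i ≠ 2 → ∀ θ : S m ≃* S m, PairShadowStandard m i θ →
    HasFiniteQuotientsOfFree m (PairQuot m i θ)

/-- Statement of `stub_profiniteFreenessDetection` (B₂; the live build's stub verbatim): PROFINITE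
DETECTION OF FREENESS for the twisted pair quotient (a theorem in print).  For `i ∈ {0, 1}`: if
`S/⟪N_i, θN₂⟫` — the fundamental group of the closed orientable 3-manifold `Y_θ = H_i ∪_Σ H_{θN₂}`
(`θN₂` is a handlebody kernel: `θ` is a mapping class by Dehn–Nielsen–Baer) — has the finite
quotients of `F_{m+1}`, then it is free of rank `m+1`.  On paper: same finite quotients of finitely
generated groups ⟹ `π̂₁(Y_θ) ≅ F̂_{m+1}` (Dixon–Formanek–Poland–Ribes 1982) ⟹ `Y_θ ≅ #^{m+1}(S¹ × S²)`
(Wilton–Zalesskii 2019 Thm 1, arXiv:1703.03701: `r = s`, `m = n`; Perelman and residual finiteness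
of 3-manifold groups inside) ⟹ `π₁(Y_θ) ≅ F_{m+1}`.  The third slot is the image of `N₂` under an
AUTOMORPHISM throughout (`S ⧸ θN₂ ≅ F_g`): NOT an instance of the refuted shadows-only strengthening
`ShadowsOnlyFalse.shadowApproximation_false_without_isGroupTrisection` (whose junk `J₂` has
`S/J₂` with 3-torsion). -/
def ProfiniteFreenessDetection : Prop :=
  ∀ (m : ℕ) (i : Fin 3), i ≠ 2 → ∀ θ : S m ≃* S m,
    HasFiniteQuotientsOfFree m (PairQuot m i θ) → IsFreeOfRank (PairQuot m i θ) (m + 1)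

/-- Statement C₀ (PROVED below, `noGhostsGenusThree_holds`; the `m = 0` dividend): at genus 3 a
twisted triple `(N₀, N₁, ρN₂)` whose triple quotient is profinitely trivial has TRIVIAL triple
quotient — that quotient is a quotient of `S₃ ⧸ (N₀ ⊔ N₁) = ⟨b₀⟩ ≅ ℤ` (`a₀, a₁, a₂, b₁, b₂` die),
hence cyclic, and a cyclic group without non-trivial finite quotients is trivial.  No fine datum. -/
def NoGhostsGenusThree : Prop :=
  ∀ ρ : S 0 ≃* S 0, ProfinitelyTrivial 0 ρ → tripleJoin 0 ρ = ⊤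

/-- Statement of `stub_limitsSimplyConnected` (C₊, OPEN — the crux's one private conjunct, genus
`3 + 3(m+1) ≥ 6`; the live build's stub verbatim): LIMITS ARE SIMPLY CONNECTED / NO FINE GHOSTS.
In the fine closure the triple quotient `G_ρ` (a quotient of `F_{m+2}` with `Ĝ_ρ = 1` by A, and — by
B — the group of a balanced handlebody triple with free pair quotients, i.e. of a smooth homology
4-sphere) is trivial.  Necessary for the crux (`limitsSimplyConnectedPos_of_crux`). -/
def LimitsSimplyConnectedPos : Prop :=
  ∀ (m : ℕ) (ρ : S (m + 1) ≃* S (m + 1)), FineClosure (m + 1) ρ → tripleJoin (m + 1) ρ = ⊤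

/-- Statement of `stub_fineApproxGenusThree` (D₀, OPEN; the line's first target): FINE
APPROXIMATION AT GENUS 3.  If `ρ ∈ Aut S₃` lies in the fine closure and `T_ρ = (N₀, N₁, ρN₂)` is a
genuine `(3; 1)` group trisection of the trivial group, then `T_ρ` is standard (`Iso N T_ρ`,
equivalently `ρ ∈ P·Q`, `inPQ_of_iso` / `iso_of_inPQ`): fine-congruent `(3;1,1,1)` homotopy-sphere
trisections glued along the standard genus-3 Heegaard surface of `S¹ × S²` are standard.  Given B₂
this is EQUIVALENT to the crux at `m = 0` (`cruxZero_iff_fineApproxGenusThree`).  First open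
trisection type (LowGenusTrisectionBarrier bounds from below only); test family: Aranda–Zupan
`T(K,τ,λ)` (arXiv:2503.04607 Q 8.2/8.3). -/
def FineApproxGenusThree : Prop :=
  ∀ ρ : S 0 ≃* S 0, FineClosure 0 ρ →
    IsGroupTrisection (3 + 3 * 0) (0 + 1) (PUnit : Type) (twisted 0 ρ) →
    TrisectionKernels.Iso (N 0) (twisted 0 ρ)

/-- Statement of `stub_fineApproxPos` (D₊, OPEN, hardest): FINE APPROXIMATION at genus `≥ 6`.  If `ρ`
lies in the fine closure and `T_ρ` is a genuine `(3+3(m+1); m+2)` group trisection of the trivial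
group, then `T_ρ` is standard.  This is the sibling crux `ShadowApproximation` ∧ `WaldhausenPairs`
restricted to the fine locus (`fineApprox_of_shadowApproximation`); what the fine locus offers
beyond 14595's hypotheses is the DISCRETE Goeritz re-marking `x_M ∈ P` at every level
(`FineClosure`), kept at full strength. -/
def FineApproxPos : Prop :=
  ∀ (m : ℕ) (ρ : S (m + 1) ≃* S (m + 1)), FineClosure (m + 1) ρ →
    IsGroupTrisection (3 + 3 * (m + 1)) (m + 1 + 1) (PUnit : Type) (twisted (m + 1) ρ) →
    TrisectionKernels.Iso (N (m + 1)) (twisted (m + 1) ρ)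

/-- Statement D = D₀ ∧ D₊ (`fineApprox_iff`; the live build's `stub_fineApprox`, verbatim up to
abbreviations). -/
def FineApprox : Prop :=
  ∀ (m : ℕ) (ρ : S m ≃* S m), FineClosure m ρ →
    IsGroupTrisection (3 + 3 * m) (m + 1) (PUnit : Type) (twisted m ρ) →
    TrisectionKernels.Iso (N m) (twisted m ρ)

/-! ## Registered stubs -/

/-- STUB B₂ (size XL to vendor, THEOREM in print: DFPR 1982 + Wilton–Zalesskii 2019 Thm 1 + Perelman;
identical with the live build's `stub_profiniteFreenessDetection`). -/
theorem stub_profiniteFreenessDetection : ProfiniteFreenessDetection := by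
  sorry

/-- STUB C₊ (OPEN; the private conjunct of rank 6; identical with the live build's
`stub_limitsSimplyConnected`; falsifier = the Kervaire–Higman fine-membership test of the card). -/
theorem stub_limitsSimplyConnected : LimitsSimplyConnectedPos := by
  sorry

/-- STUB D₀ (OPEN; genus 3, type `(3;1,1,1)`: the line's first target; the `m = 0` instance of the
live build's `stub_fineApprox`). -/
theorem stub_fineApproxGenusThree : FineApproxGenusThree := by
  sorry

/-- STUB D₊ (OPEN, hardest; the `m ≥ 1` instances of the live build's `stub_fineApprox`). -/
theorem stub_fineApproxPos : FineApproxPos := by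
  sorry

/-! ## Proved infrastructure -/

/-- The standard triple is a `(3+3m, m+1)` group trisection of `{1}` (two discharged named facts). -/
theorem stabilizeIter_isGroupTrisection (m : ℕ) :
    IsGroupTrisection (3 + 3 * m) (m + 1) (PUnit : Type) (N m) := by
  induction m with
  | zero => exact s4Kernels_isGroupTrisection_holds
  | succ m ih => exact stabilize_isGroupTrisection_holds _ _ _ _ ih

instance N_normal (m : ℕ) (i : Fin 3) : (N m i).Normal := (stabilizeIter_isGroupTrisection m).normal i

/-- At `m = 0` the standard triple is literally `s4Kernels` (genus 3: `N₀ = ⟪a₀,a₁,b₂⟫`,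
`N₁ = ⟪a₀,b₁,a₂⟫`, `N₂ = ⟪b₀,a₁,a₂⟫` in the `0`-indexed generators of `GroupTrisections.lean`). -/
theorem N_zero : N 0 = s4Kernels := rfl

instance mapN_normal (m : ℕ) (i : Fin 3) (ρ : S m ≃* S m) : ((N m i).map ρ.toMonoidHom).Normal :=
  Subgroup.Normal.map inferInstance _ ρ.surjective

instance tripleJoin_normal (m : ℕ) (ρ : S m ≃* S m) : (tripleJoin m ρ).Normal := by
  haveI : (N m 0 ⊔ N m 1).Normal := Subgroup.sup_normal _ _
  exact Subgroup.sup_normal _ _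

@[simp] theorem twisted_zero (m : ℕ) (ρ : S m ≃* S m) : twisted m ρ 0 = N m 0 := rfl
@[simp] theorem twisted_one (m : ℕ) (ρ : S m ≃* S m) : twisted m ρ 1 = N m 1 := rfl
@[simp] theorem twisted_two (m : ℕ) (ρ : S m ≃* S m) :
    twisted m ρ 2 = (N m 2).map ρ.toMonoidHom := rfl

instance twisted_normal (m : ℕ) (ρ : S m ≃* S m) (i : Fin 3) : (twisted m ρ i).Normal := by
  fin_cases i
  · exact (inferInstance : (N m 0).Normal)
  · exact (inferInstance : (N m 1).Normal)
  · exact (inferInstance : ((N m 2).map ρ.toMonoidHom).Normal)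

theorem toMonoidHom_trans {m : ℕ} (e₁ e₂ : S m ≃* S m) :
    (e₁.trans e₂).toMonoidHom = e₂.toMonoidHom.comp e₁.toMonoidHom :=
  MonoidHom.ext fun _ => rfl

theorem map_trans {m : ℕ} (e₁ e₂ : S m ≃* S m) (K : Subgroup (S m)) :
    K.map (e₁.trans e₂).toMonoidHom = (K.map e₁.toMonoidHom).map e₂.toMonoidHom := by
  rw [toMonoidHom_trans, Subgroup.map_map]

theorem map_refl {m : ℕ} (K : Subgroup (S m)) : K.map (MulEquiv.refl (S m)).toMonoidHom = K := by
  ext s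
  simp

theorem map_self_trans_symm {m : ℕ} (e : S m ≃* S m) (K : Subgroup (S m)) :
    K.map (e.trans e.symm).toMonoidHom = K := by
  have : (e.trans e.symm) = MulEquiv.refl (S m) := by
    ext s
    simp
  rw [this, map_refl]

/-- A characteristic subgroup is mapped onto itself by every automorphism. -/
theorem map_eq_of_characteristic {m : ℕ} {M : Subgroup (S m)} (hM : M.Characteristic)
    (x : S m ≃* S m) : M.map x.toMonoidHom = M :=
  (Subgroup.characteristic_iff_map_eq.1 hM) x

/-- The standard triple normally generates `S`. -/
theorem normalClosure_N_eq_top (m : ℕ) : normalClosure (⋃ i, (N m i : Set (S m))) = ⊤ := by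
  obtain ⟨e⟩ := (stabilizeIter_isGroupTrisection m).triple
  haveI : Subsingleton (TrisectionKernels.tripleQuotient (N m)) := e.toEquiv.subsingleton
  exact QuotientGroup.subgroup_eq_top_of_subsingleton _ inferInstance

/-- `N₀ ⊔ N₁ ⊔ N₂ = ⊤`. -/
theorem sup_N_eq_top (m : ℕ) : N m 0 ⊔ N m 1 ⊔ N m 2 = ⊤ := by
  rw [eq_top_iff, ← normalClosure_N_eq_top m]
  refine normalClosure_le_normal (Set.iUnion_subset fun i => ?_)
  fin_cases i
  · exact fun s hs => mem_sup_left (mem_sup_left hs)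
  · exact fun s hs => mem_sup_left (mem_sup_right hs)
  · exact fun s hs => mem_sup_right hs

/-- The normal closure of the union of two normal subgroups is their join. -/
theorem normalClosure_union_eq_sup {G : Type*} [Group G] (A B : Subgroup G) [A.Normal] [B.Normal] :
    normalClosure ((A : Set G) ∪ B) = A ⊔ B := by
  apply le_antisymm
  · haveI : (A ⊔ B).Normal := Subgroup.sup_normal A B
    exact normalClosure_le_normal
      (Set.union_subset (fun x hx => mem_sup_left hx) (fun x hx => mem_sup_right hx))
  · exact sup_le (fun x hx => subset_normalClosure (Or.inl hx))
      (fun x hx => subset_normalClosure (Or.inr hx))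

/-- Pointwise congruence `ρ ≡ x ∘ c (mod M)` moves images of subgroups only within `M`. -/
theorem map_sup_eq_of_congr {m : ℕ} {ρ x c : S m ≃* S m} {M : Subgroup (S m)}
    (h : ∀ s, ρ s * (x (c s))⁻¹ ∈ M) (H : Subgroup (S m)) :
    H.map ρ.toMonoidHom ⊔ M = (H.map c.toMonoidHom).map x.toMonoidHom ⊔ M := by
  apply le_antisymm
  · refine sup_le ?_ le_sup_right
    rintro _ ⟨s, hs, rfl⟩
    have : ρ s = (ρ s * (x (c s))⁻¹) * x (c s) := by group
    rw [MulEquiv.coe_toMonoidHom, this]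
    exact mul_mem (mem_sup_right (h s)) (mem_sup_left ⟨c s, ⟨s, hs, rfl⟩, rfl⟩)
  · refine sup_le ?_ le_sup_right
    rintro _ ⟨_, ⟨s, hs, rfl⟩, rfl⟩
    have : x (c s) = (ρ s * (x (c s))⁻¹)⁻¹ * ρ s := by group
    rw [MulEquiv.coe_toMonoidHom, MulEquiv.coe_toMonoidHom, this]
    exact mul_mem (mem_sup_right (inv_mem (h s))) (mem_sup_left ⟨s, hs, rfl⟩)

/-- A carrier `x ∈ Stab N₀ ∩ Stab N₁` of `N₂` modulo `M` collapses the triple join modulo `M`. -/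
theorem tripleJoin_sup_eq_top_of_carrier {m : ℕ} {ρ x : S m ≃* S m} {M : Subgroup (S m)} [M.Normal]
    (h0 : (N m 0).map x.toMonoidHom = N m 0) (h1 : (N m 1).map x.toMonoidHom = N m 1)
    (h2 : (N m 2).map ρ.toMonoidHom ⊔ M = (N m 2).map x.toMonoidHom ⊔ M) :
    tripleJoin m ρ ⊔ M = ⊤ := by
  have hx : Function.Surjective x.toMonoidHom := x.surjective
  have key : (⊤ : Subgroup (S m)).map x.toMonoidHom ≤ tripleJoin m ρ ⊔ M := by
    rw [← normalClosure_N_eq_top m, map_normalClosure _ _ hx]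
    refine normalClosure_le_normal ?_
    rintro _ ⟨s, hs, rfl⟩
    simp only [Set.mem_iUnion, SetLike.mem_coe] at hs
    obtain ⟨i, hi⟩ := hs
    fin_cases i
    · exact mem_sup_left (mem_sup_left (mem_sup_left (h0.le ⟨s, hi, rfl⟩)))
    · exact mem_sup_left (mem_sup_left (mem_sup_right (h1.le ⟨s, hi, rfl⟩)))
    · have : x.toMonoidHom s ∈ (N m 2).map ρ.toMonoidHom ⊔ M := by
        rw [h2]; exact mem_sup_left ⟨s, hi, rfl⟩
      exact (sup_le_sup_right le_sup_right M) this
  rw [eq_top_iff]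
  refine le_trans ?_ key
  rw [← MonoidHom.range_eq_map, MonoidHom.range_eq_top.2 hx]

/-- **LEVEL COLLAPSE (the lever, proved).**  In the fine closure, `(N₀ ⊔ N₁ ⊔ ρN₂) ⊔ M = ⊤` for
every characteristic finite-index `M`: every finite CHARACTERISTIC quotient of `G_ρ` dies. -/
theorem tripleJoin_sup_eq_top_of_fineClosure {m : ℕ} {ρ : S m ≃* S m} (h : FineClosure m ρ)
    (M : Subgroup (S m)) (hM : M.Characteristic) (hF : M.FiniteIndex) : tripleJoin m ρ ⊔ M = ⊤ := by
  obtain ⟨x, c, hx0, hx1, hc, hs⟩ := h M hM hF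
  haveI := hM
  haveI : M.Normal := inferInstance
  refine tripleJoin_sup_eq_top_of_carrier hx0 hx1 ?_
  rw [map_sup_eq_of_congr hs (N m 2), hc]

/-! ### Statement A is a theorem: the characteristic core and profinite collapse -/

/-- Homomorphisms from the finitely presented `S m` to a finite group form a finite set
(a homomorphism is determined by the images of the `2(3+3m)` generators). -/
instance finite_monoidHom (m : ℕ) (G : Type) [Group G] [Finite G] : Finite (S m →* G) :=
  Finite.of_injective
    (fun φ : S m →* G => fun p : surfaceGen (3 + 3 * m) => φ (PresentedGroup.of p))
    (fun _ _ h => PresentedGroup.ext fun p => congrFun h p)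

/-- The CHARACTERISTIC CORE of `S m` at a finite group `G`: `⋂_{φ : S → G} ker φ`. -/
def charCore (m : ℕ) (G : Type) [Group G] : Subgroup (S m) := ⨅ φ : S m →* G, φ.ker

theorem charCore_le_ker {m : ℕ} {G : Type} [Group G] (f : S m →* G) : charCore m G ≤ f.ker :=
  iInf_le (fun φ : S m →* G => φ.ker) f

/-- The characteristic core is characteristic (automorphisms permute the `φ : S → G`). -/
theorem charCore_characteristic (m : ℕ) (G : Type) [Group G] : (charCore m G).Characteristic := by
  refine Subgroup.characteristic_iff_le_comap.2 fun ϕ s hs => ?_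
  rw [Subgroup.mem_comap]
  simp only [charCore, Subgroup.mem_iInf, MonoidHom.mem_ker] at hs ⊢
  intro φ
  exact hs (φ.comp ϕ.toMonoidHom)

/-- … and of finite index when `G` is finite (finitely many kernels of finite index). -/
instance charCore_finiteIndex (m : ℕ) (G : Type) [Group G] [Finite G] : (charCore m G).FiniteIndex :=
  Subgroup.finiteIndex_iInf fun _ => inferInstance

/-- **PROFINITE COLLAPSE (Statement A, proved).**  In the fine closure every homomorphism from `S`
to a finite group killing `N₀, N₁, ρN₂` is trivial: `Ĝ_ρ = 1`. -/
theorem profiniteCollapse_holds : ProfiniteCollapse := by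
  intro m ρ hρ G _ _ f hf s
  have htop := tripleJoin_sup_eq_top_of_fineClosure hρ (charCore m G) (charCore_characteristic m G)
    inferInstance
  have hle : tripleJoin m ρ ⊔ charCore m G ≤ f.ker := sup_le hf (charCore_le_ker f)
  rw [htop, top_le_iff] at hle
  have hs : s ∈ f.ker := by rw [hle]; exact Subgroup.mem_top s
  exact hs

/-- **PAIR SHADOWS (proved).**  In the fine closure each pair `(N_i, ρN₂)`, `i = 0, 1`, is
shadow-standard at every characteristic finite-index level (witness `a := x_M`). -/
theorem pairShadow_of_fineClosure {m : ℕ} {ρ : S m ≃* S m} (h : FineClosure m ρ) (i : Fin 3)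
    (hi : i ≠ 2) : PairShadowStandard m i ρ := by
  intro M hM hF
  obtain ⟨x, c, hx0, hx1, hc, hs⟩ := h M hM hF
  have hxM : M.map x.toMonoidHom = M := map_eq_of_characteristic hM x
  have hxi : (N m i).map x.toMonoidHom = N m i := by
    fin_cases i
    · exact hx0
    · exact hx1
    · exact (hi rfl).elim
  refine ⟨x, ?_, ?_⟩
  · rw [Subgroup.map_sup, hxi, hxM]
  · rw [Subgroup.map_sup, hxM, map_sup_eq_of_congr hs (N m 2), hc]

/-- **TRIPLE SHADOWS (proved).**  In the fine closure all finite characteristic shadows of `T_ρ`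
are standard, simultaneously (witness `ψ := x_M`): the shadow hypothesis of `ShadowApproximation`. -/
theorem shadow_of_fineClosure {m : ℕ} {ρ : S m ≃* S m} (h : FineClosure m ρ)
    (M : Subgroup (S m)) (hM : M.Characteristic) (hF : M.FiniteIndex) :
    ∃ ψ : S m ≃* S m, ∀ i : Fin 3, (N m i ⊔ M).map ψ.toMonoidHom = twisted m ρ i ⊔ M := by
  obtain ⟨x, c, hx0, hx1, hc, hs⟩ := h M hM hF
  have hxM : M.map x.toMonoidHom = M := map_eq_of_characteristic hM x
  refine ⟨x, fun i => ?_⟩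
  fin_cases i
  · show (N m 0 ⊔ M).map x.toMonoidHom = N m 0 ⊔ M
    rw [Subgroup.map_sup, hx0, hxM]
  · show (N m 1 ⊔ M).map x.toMonoidHom = N m 1 ⊔ M
    rw [Subgroup.map_sup, hx1, hxM]
  · show (N m 2 ⊔ M).map x.toMonoidHom = (N m 2).map ρ.toMonoidHom ⊔ M
    rw [Subgroup.map_sup, hxM, map_sup_eq_of_congr hs (N m 2), hc]

/-! ### Statement B₁ is a theorem: level transport of finite quotients -/

/-- Transport of a finite quotient along an automorphism: if `a(A) ≤ B ⊔ core(Q)`, a surjection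
onto `Q` killing `B` pulls back along `a` to a surjection killing `A`. -/
theorem isQuotientOver_of_map_le {m : ℕ} {A B : Subgroup (S m)} {Q : Type} [Group Q] [Finite Q]
    (a : S m ≃* S m) (hle : A.map a.toMonoidHom ≤ B ⊔ charCore m Q) (hB : IsQuotientOver B Q) :
    IsQuotientOver A Q := by
  obtain ⟨f, hf, hker⟩ := hB
  refine ⟨f.comp a.toMonoidHom, hf.comp a.surjective, ?_⟩
  intro s hs
  rw [MonoidHom.mem_ker, MonoidHom.comp_apply]
  have h1 : a.toMonoidHom s ∈ B ⊔ charCore m Q := hle ⟨s, hs, rfl⟩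
  have h2 : B ⊔ charCore m Q ≤ f.ker := sup_le hker (charCore_le_ker f)
  exact h2 h1

/-- **LEVEL TRANSPORT (Statement B₁, engine form, proved).**  A pair `(N_i, θN₂)` that is
shadow-standard at every characteristic finite-index level has the same finite quotients over `S`
as the standard pair: a surjection `S ↠ Q` killing one pair is carried to one killing the other by
the level automorphism at the characteristic core of `Q`. -/
theorem pairFiniteQuotients_holds : PairFiniteQuotients := by
  intro m i _ θ hθ Q _ _
  obtain ⟨a, hai, ha2⟩ := hθ (charCore m Q) (charCore_characteristic m Q) inferInstance
  have hNi : (N m i).map a.toMonoidHom ≤ N m i ⊔ charCore m Q := by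
    calc (N m i).map a.toMonoidHom ≤ (N m i ⊔ charCore m Q).map a.toMonoidHom :=
          Subgroup.map_mono le_sup_left
      _ = N m i ⊔ charCore m Q := hai
  have hN2 : (N m 2).map a.toMonoidHom ≤ (N m 2).map θ.toMonoidHom ⊔ charCore m Q := by
    calc (N m 2).map a.toMonoidHom ≤ (N m 2 ⊔ charCore m Q).map a.toMonoidHom :=
          Subgroup.map_mono le_sup_left
      _ = (N m 2).map θ.toMonoidHom ⊔ charCore m Q := ha2
  have hNi' : (N m i).map a.symm.toMonoidHom ≤ N m i ⊔ charCore m Q := by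
    have e : (N m i ⊔ charCore m Q).map a.symm.toMonoidHom = N m i ⊔ charCore m Q := by
      conv_lhs => rw [← hai]
      rw [← map_trans, map_self_trans_symm]
    calc (N m i).map a.symm.toMonoidHom ≤ (N m i ⊔ charCore m Q).map a.symm.toMonoidHom :=
          Subgroup.map_mono le_sup_left
      _ = N m i ⊔ charCore m Q := e
  have hN2' : ((N m 2).map θ.toMonoidHom).map a.symm.toMonoidHom ≤ N m 2 ⊔ charCore m Q := by
    have e : ((N m 2).map θ.toMonoidHom ⊔ charCore m Q).map a.symm.toMonoidHom =
        N m 2 ⊔ charCore m Q := by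
      conv_lhs => rw [← ha2]
      rw [← map_trans, map_self_trans_symm]
    calc ((N m 2).map θ.toMonoidHom).map a.symm.toMonoidHom
          ≤ ((N m 2).map θ.toMonoidHom ⊔ charCore m Q).map a.symm.toMonoidHom :=
          Subgroup.map_mono le_sup_left
      _ = N m 2 ⊔ charCore m Q := e
  constructor
  · intro h
    refine isQuotientOver_of_map_le a ?_ h
    rw [Subgroup.map_sup]
    exact sup_le (hNi.trans (sup_le_sup_right le_sup_left _))
      (hN2.trans (sup_le_sup_right le_sup_right _))
  · intro h
    refine isQuotientOver_of_map_le a.symm ?_ h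
    rw [Subgroup.map_sup]
    exact sup_le (hNi'.trans (sup_le_sup_right le_sup_left _))
      (hN2'.trans (sup_le_sup_right le_sup_right _))

/-- Finite quotients of `S ⧸ A` are the finite quotients over `A`. -/
theorem exists_surjective_quotient_iff {m : ℕ} (A : Subgroup (S m)) [A.Normal]
    (Q : Type) [Group Q] : (∃ f : S m ⧸ A →* Q, Function.Surjective f) ↔ IsQuotientOver A Q := by
  constructor
  · rintro ⟨f, hf⟩
    refine ⟨f.comp (QuotientGroup.mk' A), hf.comp (QuotientGroup.mk'_surjective A), ?_⟩
    intro s hs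
    rw [MonoidHom.mem_ker, MonoidHom.comp_apply, QuotientGroup.mk'_apply,
      (QuotientGroup.eq_one_iff s).2 hs, map_one]
  · rintro ⟨f, hf, hker⟩
    refine ⟨QuotientGroup.lift A f hker, fun q => ?_⟩
    obtain ⟨s, rfl⟩ := hf q
    exact ⟨QuotientGroup.mk s, by simp⟩

/-- Surjections onto `Q` transport along a group isomorphism. -/
theorem exists_surjective_congr {G H : Type} [Group G] [Group H] (e : G ≃* H)
    (Q : Type) [Group Q] :
    (∃ f : G →* Q, Function.Surjective f) ↔ (∃ f : H →* Q, Function.Surjective f) :=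
  ⟨fun ⟨f, hf⟩ => ⟨f.comp e.symm.toMonoidHom, hf.comp e.symm.surjective⟩,
    fun ⟨f, hf⟩ => ⟨f.comp e.toMonoidHom, hf.comp e.surjective⟩⟩

/-- **LEVEL TRANSPORT, live-build form (proved).**  This is the lead's registered
`stub_pairShadowFiniteQuotients` (skeleton `01bbf8c2e032`), verbatim up to the abbreviations
`S`, `N`, `PairQuot`, `HasFiniteQuotientsOfFree`: the twisted pair quotient `S/⟪N_i, θN₂⟫` has the
finite quotients of `F_{m+1}` (`≅` the standard pair quotient, `free_pairQuotient`). -/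
theorem pairShadowFiniteQuotients_holds : PairShadowFiniteQuotients := by
  intro m i hi θ hθ Q _ _
  have key := pairFiniteQuotients_holds m i hi θ hθ Q
  obtain ⟨e⟩ := (stabilizeIter_isGroupTrisection m).free_pairQuotient i 2 hi
  rw [exists_surjective_quotient_iff, normalClosure_union_eq_sup, key,
    exists_surjective_congr e Q, exists_surjective_quotient_iff, normalClosure_union_eq_sup]

/-! ### Statement C₀ is a theorem: cyclic collapse at genus 3

At genus 3 every generator except `b₀` dies in `N₀ ⊔ N₁` (`N₀ = ⟪a₀,a₁,b₂⟫`, `N₁ = ⟪a₀,b₁,a₂⟫`), so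
`G_ρ = S₃ ⧸ (N₀ ⊔ N₁ ⊔ ρN₂)` is CYCLIC, `≅ Multiplicative (ZMod (Nat.card G_ρ))`; if it were
non-trivial it would surject onto `ℤ/p` for a prime `p ∣ Nat.card G_ρ` (`Nat.card = 0` in the
infinite case, `ZMod 0 = ℤ`), contradicting profinite triviality.  (Same computation as the sibling
line `pair-rigidity-retraction`'s `tripleJoin_zero_eq_top`, here from the weaker hypothesis
`ProfinitelyTrivial` alone.) -/

section GenusThree

/-- At genus 3 every generator other than `b₀` lies in `N₀ ⊔ N₁ ≤ tripleJoin 0 ρ`. -/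
theorem of_mem_tripleJoin_zero (ρ : S 0 ≃* S 0) (p : surfaceGen 3) (hp : p ≠ (0, true)) :
    (PresentedGroup.of p : S 0) ∈ tripleJoin 0 ρ := by
  have h0 : ∀ x ∈ ({SurfaceGroup.a 0, SurfaceGroup.a 1, SurfaceGroup.b 2} : Set (SurfaceGroup 3)),
      (x : S 0) ∈ tripleJoin 0 ρ := fun x hx =>
    mem_sup_left (mem_sup_left (show x ∈ s4Kernels 0 from subset_normalClosure hx))
  have h1 : ∀ x ∈ ({SurfaceGroup.a 0, SurfaceGroup.b 1, SurfaceGroup.a 2} : Set (SurfaceGroup 3)),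
      (x : S 0) ∈ tripleJoin 0 ρ := fun x hx =>
    mem_sup_left (mem_sup_right (show x ∈ s4Kernels 1 from subset_normalClosure hx))
  obtain ⟨i, bit⟩ := p
  fin_cases i <;> cases bit
  · exact h0 _ (by simp [SurfaceGroup.a])
  · exact absurd rfl hp
  · exact h0 _ (by simp [SurfaceGroup.a])
  · exact h1 _ (by simp [SurfaceGroup.b])
  · exact h1 _ (by simp [SurfaceGroup.a])
  · exact h0 _ (by simp [SurfaceGroup.b])

/-- Hence `G_ρ = S₃ ⧸ tripleJoin 0 ρ` is cyclic, generated by the image of `b₀`. -/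
theorem zpowers_b0_eq_top (ρ : S 0 ≃* S 0) :
    Subgroup.zpowers ((QuotientGroup.mk (SurfaceGroup.b 0 : S 0)) : S 0 ⧸ tripleJoin 0 ρ) = ⊤ := by
  rw [eq_top_iff, ← Subgroup.map_top_of_surjective _ (QuotientGroup.mk'_surjective (tripleJoin 0 ρ)),
    ← PresentedGroup.closure_range_of, MonoidHom.map_closure, Subgroup.closure_le]
  rintro _ ⟨_, ⟨p, rfl⟩, rfl⟩
  by_cases hp : p = (0, true)
  · subst hp
    exact Subgroup.mem_zpowers _
  · rw [SetLike.mem_coe, QuotientGroup.mk'_apply,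
      (QuotientGroup.eq_one_iff _).2 (of_mem_tripleJoin_zero ρ p hp)]
    exact one_mem _

/-- **NO GHOSTS AT GENUS 3 (Statement C₀, proved).**  A profinitely trivial twisted triple quotient
of genus 3 is trivial. -/
theorem noGhostsGenusThree_holds : NoGhostsGenusThree := by
  intro ρ hprof
  by_contra hne
  have hcyc : IsCyclic (S 0 ⧸ tripleJoin 0 ρ) :=
    isCyclic_iff_exists_zpowers_eq_top.2 ⟨_, zpowers_b0_eq_top ρ⟩
  haveI hnt : Nontrivial (S 0 ⧸ tripleJoin 0 ρ) := by
    by_contra hc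
    rw [not_nontrivial_iff_subsingleton] at hc
    exact hne (QuotientGroup.subgroup_eq_top_of_subsingleton _ hc)
  have hcard : Nat.card (S 0 ⧸ tripleJoin 0 ρ) ≠ 1 := fun hc =>
    not_subsingleton _ (Nat.card_eq_one_iff_unique.1 hc).1
  obtain ⟨p, hp, hpd⟩ := Nat.exists_prime_and_dvd hcard
  haveI : Fact p.Prime := ⟨hp⟩
  let e : Multiplicative (ZMod (Nat.card (S 0 ⧸ tripleJoin 0 ρ))) ≃* S 0 ⧸ tripleJoin 0 ρ :=
    zmodCyclicMulEquiv hcyc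
  let r : Multiplicative (ZMod (Nat.card (S 0 ⧸ tripleJoin 0 ρ))) →* Multiplicative (ZMod p) :=
    AddMonoidHom.toMultiplicative (ZMod.castHom hpd (ZMod p)).toAddMonoidHom
  let f : S 0 →* Multiplicative (ZMod p) :=
    r.comp (e.symm.toMonoidHom.comp (QuotientGroup.mk' (tripleJoin 0 ρ)))
  have hr : Function.Surjective r := fun y => by
    obtain ⟨x, hx⟩ := ZMod.ringHom_surjective (ZMod.castHom hpd (ZMod p)) y.toAdd
    exact ⟨Multiplicative.ofAdd x, by simp [r, hx]⟩
  have hf : Function.Surjective f :=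
    hr.comp (e.symm.surjective.comp (QuotientGroup.mk'_surjective _))
  have hker : tripleJoin 0 ρ ≤ f.ker := by
    intro s hs
    rw [MonoidHom.mem_ker]
    simp [f, (QuotientGroup.eq_one_iff s).2 hs]
  have htriv : ∀ s, f s = 1 := hprof (Multiplicative (ZMod p)) f hker
  obtain ⟨s, hs⟩ := hf (Multiplicative.ofAdd 1)
  have h1 := htriv s
  rw [hs] at h1
  simp at h1

end GenusThree

/-! ### From free pairs and trivial triple join to a group trisection of `{1}` -/

/-- Pair quotients are symmetric in the two slots. -/
theorem isFreeOfRank_pairQuotient_symm {g k : ℕ} (K : TrisectionKernels g) (i j : Fin 3)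
    [(normalClosure ((K i : Set (SurfaceGroup g)) ∪ K j)).Normal]
    [(normalClosure ((K j : Set (SurfaceGroup g)) ∪ K i)).Normal]
    (h : IsFreeOfRank (K.pairQuotient i j) k) : IsFreeOfRank (K.pairQuotient j i) k :=
  h.of_mulEquiv (QuotientGroup.quotientMulEquivOfEq (by rw [Set.union_comm]))

/-- `tripleJoin = ⊤` ⟹ the normal closure of `T_ρ` is everything. -/
theorem normalClosure_twisted_eq_top {m : ℕ} {ρ : S m ≃* S m} (h : tripleJoin m ρ = ⊤) :
    normalClosure (⋃ i, (twisted m ρ i : Set (S m))) = ⊤ := by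
  have le : ∀ i : Fin 3, twisted m ρ i ≤ normalClosure (⋃ i, (twisted m ρ i : Set (S m))) :=
    fun i s hs => subset_normalClosure (Set.mem_iUnion.2 ⟨i, hs⟩)
  rw [eq_top_iff, ← h]
  exact sup_le (sup_le (le 0) (le 1)) (le 2)

/-- **`T_ρ` is a group trisection of `{1}`** as soon as its two twisted pair quotients are free of
rank `m+1` (B) and its triple join is everything (C). -/
theorem isGroupTrisection_twisted {m : ℕ} {ρ : S m ≃* S m}
    (h02 : IsFreeOfRank (PairQuot m 0 ρ) (m + 1)) (h12 : IsFreeOfRank (PairQuot m 1 ρ) (m + 1))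
    (htop : tripleJoin m ρ = ⊤) :
    IsGroupTrisection (3 + 3 * m) (m + 1) (PUnit : Type) (twisted m ρ) := by
  have hN := stabilizeIter_isGroupTrisection m
  refine ⟨fun i => inferInstance, ?_, ?_, ?_⟩
  · -- single quotients: slots 0, 1 are standard; slot 2 is transported along `ρ`
    intro i
    fin_cases i
    · exact hN.free_quotient 0
    · exact hN.free_quotient 1
    · have h2 := hN.free_quotient 2
      change IsFreeOfRank (S m ⧸ normalClosure
        (((N m 2).map ρ.toMonoidHom : Subgroup (S m)) : Set (S m))) (3 + 3 * m)
      have e₁ : S m ⧸ normalClosure ((N m 2 : Subgroup (S m)) : Set (S m)) ≃* S m ⧸ N m 2 :=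
        QuotientGroup.quotientMulEquivOfEq (normalClosure_eq_self _)
      have e₂ : S m ⧸ N m 2 ≃* S m ⧸ (N m 2).map ρ.toMonoidHom :=
        QuotientGroup.congr (N m 2) ((N m 2).map ρ.toMonoidHom) ρ rfl
      have e₃ : S m ⧸ (N m 2).map ρ.toMonoidHom ≃*
          S m ⧸ normalClosure (((N m 2).map ρ.toMonoidHom : Subgroup (S m)) : Set (S m)) :=
        QuotientGroup.quotientMulEquivOfEq (normalClosure_eq_self _).symm
      exact ((h2.of_mulEquiv e₁).of_mulEquiv e₂).of_mulEquiv e₃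
  · -- pair quotients: (0,1) standard, (0,2) and (1,2) by hypothesis, the rest by symmetry
    have h02' : IsFreeOfRank ((twisted m ρ).pairQuotient 0 2) (m + 1) := h02
    have h12' : IsFreeOfRank ((twisted m ρ).pairQuotient 1 2) (m + 1) := h12
    have h01' : IsFreeOfRank ((twisted m ρ).pairQuotient 0 1) (m + 1) :=
      hN.free_pairQuotient 0 1 (by decide)
    intro i j hij
    fin_cases i <;> fin_cases j
    · exact (hij rfl).elim
    · exact h01'
    · exact h02'
    · exact isFreeOfRank_pairQuotient_symm _ _ _ h01'
    · exact (hij rfl).elim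
    · exact h12'
    · exact isFreeOfRank_pairQuotient_symm _ _ _ h02'
    · exact isFreeOfRank_pairQuotient_symm _ _ _ h12'
    · exact (hij rfl).elim
  · -- triple quotient: trivial by C
    have hnc := normalClosure_twisted_eq_top htop
    haveI : Subsingleton ((twisted m ρ).tripleQuotient) := by
      change Subsingleton (S m ⧸ normalClosure (⋃ i, (twisted m ρ i : Set (S m))))
      rw [hnc]
      exact QuotientGroup.subsingleton_quotient_top
    letI : Unique ((twisted m ρ).tripleQuotient) := uniqueOfSubsingleton 1
    exact ⟨MulEquiv.ofUnique⟩

/-- `Iso N T_ρ ⟹ ρ ∈ P·Q` (with `x := α`, `c := ρ ∘ α⁻¹`). -/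
theorem inPQ_of_iso {m : ℕ} {ρ : S m ≃* S m} (h : TrisectionKernels.Iso (N m) (twisted m ρ)) :
    InPQ m ρ := by
  obtain ⟨α, hα⟩ := h
  have h0 : (N m 0).map α.toMonoidHom = N m 0 := hα 0
  have h1 : (N m 1).map α.toMonoidHom = N m 1 := hα 1
  have h2 : (N m 2).map α.toMonoidHom = (N m 2).map ρ.toMonoidHom := hα 2
  refine ⟨α, ρ.trans α.symm, h0, h1, ?_, fun s => by simp⟩
  rw [map_trans, ← h2, ← map_trans, map_self_trans_symm]

/-- Conversely `ρ ∈ P·Q ⟹ Iso N T_ρ`. -/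
theorem iso_of_inPQ {m : ℕ} {ρ : S m ≃* S m} (h : InPQ m ρ) :
    TrisectionKernels.Iso (N m) (twisted m ρ) := by
  obtain ⟨x, c, hx0, hx1, hc, hs⟩ := h
  refine ⟨x, fun i => ?_⟩
  fin_cases i
  · exact hx0
  · exact hx1
  · show (N m 2).map x.toMonoidHom = (N m 2).map ρ.toMonoidHom
    have hρ : ρ = c.trans x := MulEquiv.ext fun s => hs s
    rw [hρ, map_trans, hc]

/-- D = D₀ ∧ D₊. -/
theorem fineApprox_iff : FineApprox ↔ FineApproxGenusThree ∧ FineApproxPos := by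
  constructor
  · exact fun h => ⟨fun ρ hρ hK => h 0 ρ hρ hK, fun m ρ hρ hK => h (m + 1) ρ hρ hK⟩
  · rintro ⟨h0, hpos⟩ m ρ hρ hK
    cases m with
    | zero => exact h0 ρ hρ hK
    | succ k => exact hpos k ρ hρ hK

/-! ## The composition (sorry-free): the registered stubs conclude the crux BY NAME -/

/-- Per-`ρ` normal form of the line: A (proved), B (B₁ proved + B₂), C (C₀ proved + C₊) make `T_ρ`
a group trisection of `{1}`. -/
theorem isGroupTrisection_twisted_of_fineClosure (hB : ProfiniteFreenessDetection)
    (hC : LimitsSimplyConnectedPos) (m : ℕ) (ρ : S m ≃* S m) (hρ : FineClosure m ρ) :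
    IsGroupTrisection (3 + 3 * m) (m + 1) (PUnit : Type) (twisted m ρ) := by
  have h02 : IsFreeOfRank (PairQuot m 0 ρ) (m + 1) := hB m 0 (by decide) ρ
    (pairShadowFiniteQuotients_holds m 0 (by decide) ρ (pairShadow_of_fineClosure hρ 0 (by decide)))
  have h12 : IsFreeOfRank (PairQuot m 1 ρ) (m + 1) := hB m 1 (by decide) ρ
    (pairShadowFiniteQuotients_holds m 1 (by decide) ρ (pairShadow_of_fineClosure hρ 1 (by decide)))
  have htop : tripleJoin m ρ = ⊤ := by
    cases m with
    | zero => exact noGhostsGenusThree_holds ρ (profiniteCollapse_holds 0 ρ hρ)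
    | succ k => exact hC k ρ hρ
  exact isGroupTrisection_twisted h02 h12 htop

/-- Per-`ρ` composition: B₂, C₊ and D give `ρ ∈ P·Q` for every fine limit `ρ`. -/
theorem inPQ_of_fineClosure (hB : ProfiniteFreenessDetection) (hC : LimitsSimplyConnectedPos)
    (hD : FineApprox) (m : ℕ) (ρ : S m ≃* S m) (hρ : FineClosure m ρ) : InPQ m ρ :=
  inPQ_of_iso (hD m ρ hρ (isGroupTrisection_twisted_of_fineClosure hB hC m ρ hρ))

/-- **COMPOSITION, arrow form (sorry-free, axioms propext / Classical.choice / Quot.sound).**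
`ProfiniteFreenessDetection → LimitsSimplyConnectedPos → FineApproxGenusThree → FineApproxPos →
(∀ m ρ, FineClosure m ρ → InPQ m ρ)`, the right-hand side being the crux read through `crux_iff`
(`Iff.rfl`).  Stated with the unfolded conclusion on purpose: the gate's skeleton audit takes THE
theorem concluding the crux by name, which is the next one. -/
theorem composition :
    ProfiniteFreenessDetection → LimitsSimplyConnectedPos → FineApproxGenusThree → FineApproxPos →
      ∀ (m : ℕ) (ρ : S m ≃* S m), FineClosure m ρ → InPQ m ρ :=
  fun hB hC hD₀ hD => inPQ_of_fineClosure hB hC (fineApprox_iff.2 ⟨hD₀, hD⟩)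

/-- **THE SKELETON THEOREM.**  Concludes the crux BY NAME from the four registered stubs
(B₂, C₊, D₀, D₊) through the sorry-free `composition` (A, B₁, C₀ enter as theorems); its only
non-whitelisted axiom is the stubs' `sorryAx`. -/
theorem HeegaardHandlebodyCongruenceClosed_of : HeegaardHandlebodyCongruenceClosed :=
  crux_iff.2 (composition stub_profiniteFreenessDetection stub_limitsSimplyConnected
    stub_fineApproxGenusThree stub_fineApproxPos)

/-! ## Genus 3 on its own: the crux at `m = 0` needs only B₂ (at `m = 0`) and D₀ -/

/-- **The crux at genus 3 from B₂ and D₀ alone** (A, B₁, C₀ are theorems). -/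
theorem cruxZero_of (hB : ProfiniteFreenessDetection) (hD₀ : FineApproxGenusThree) :
    ∀ ρ : S 0 ≃* S 0, FineClosure 0 ρ → InPQ 0 ρ := by
  intro ρ hρ
  refine inPQ_of_iso (hD₀ ρ hρ ?_)
  have h02 : IsFreeOfRank (PairQuot 0 0 ρ) (0 + 1) := hB 0 0 (by decide) ρ
    (pairShadowFiniteQuotients_holds 0 0 (by decide) ρ (pairShadow_of_fineClosure hρ 0 (by decide)))
  have h12 : IsFreeOfRank (PairQuot 0 1 ρ) (0 + 1) := hB 0 1 (by decide) ρ
    (pairShadowFiniteQuotients_holds 0 1 (by decide) ρ (pairShadow_of_fineClosure hρ 1 (by decide)))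
  exact isGroupTrisection_twisted h02 h12 (noGhostsGenusThree_holds ρ (profiniteCollapse_holds 0 ρ hρ))

/-- **Genus-3 normal form** (TRIAGE-r1-2's requested line target).  Given B₂, the crux AT `m = 0`
is EQUIVALENT to D₀: genus 3 is ghost-free (C₀ proved) and level transport is proved (B₁), so rank 6
there is exactly "fine-congruent `(3;1,1,1)` homotopy-sphere trisections `(N₀, N₁, ρN₂)` are
standard". -/
theorem cruxZero_iff_fineApproxGenusThree (hB : ProfiniteFreenessDetection) :
    (∀ ρ : S 0 ≃* S 0, FineClosure 0 ρ → InPQ 0 ρ) ↔ FineApproxGenusThree :=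
  ⟨fun h ρ hρ _ => iso_of_inPQ (h ρ hρ), fun h => cruxZero_of hB h⟩

/-! ## The exit through the sibling cruxes: `FineApprox ⟸ ShadowApproximation ∧ WaldhausenPairs` -/

/-- **D is 14595 ∧ 14592 on the fine locus (proved).**  The sibling crux `ShadowApproximation`
(stmt-14595) together with `WaldhausenPairs` (stmt-14592, which supplies 14595's normalisation
hypothesis for the genuine group trisection `T_ρ`) implies `FineApprox` (hence D₀ and D₊,
`fineApprox_iff`): the fine datum supplies the standard shadows (`shadow_of_fineClosure`). -/
theorem fineApprox_of_shadowApproximation (hSA : ShadowApproximation) (hW : WaldhausenPairs) :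
    FineApprox :=
  fun m ρ hρ hK => hSA m (twisted m ρ) hK (hW m (twisted m ρ) hK) (shadow_of_fineClosure hρ)

/-- Hence the whole crux (read through `crux_iff`) from B₂, C₊ and the sibling cruxes. -/
theorem crux_of_shadowApproximation (hB : ProfiniteFreenessDetection) (hC : LimitsSimplyConnectedPos)
    (hSA : ShadowApproximation) (hW : WaldhausenPairs) :
    ∀ (m : ℕ) (ρ : S m ≃* S m), FineClosure m ρ → InPQ m ρ :=
  inPQ_of_fineClosure hB hC (fineApprox_of_shadowApproximation hSA hW)

/-! ## Certificates (sorry-free): non-vacuity and necessity of the open stubs -/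

/-- Non-vacuity: products satisfy the hypothesis (at every level). -/
theorem fineClosure_of_inPQ {m : ℕ} {ρ : S m ≃* S m} (h : InPQ m ρ) : FineClosure m ρ := by
  obtain ⟨x, c, hx0, hx1, hc, hs⟩ := h
  exact fun M _ _ => ⟨x, c, hx0, hx1, hc, fun s => by simp [hs s]⟩

/-- Non-vacuity: the identity is a product. -/
theorem inPQ_refl (m : ℕ) : InPQ m (MulEquiv.refl _) :=
  ⟨MulEquiv.refl _, MulEquiv.refl _, map_refl _, map_refl _, map_refl _, fun _ => rfl⟩

/-- A product has trivial twisted triple quotient. -/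
theorem tripleJoin_eq_top_of_inPQ {m : ℕ} {ρ : S m ≃* S m} (h : InPQ m ρ) : tripleJoin m ρ = ⊤ := by
  obtain ⟨x, hx⟩ := iso_of_inPQ h
  have h0 : (N m 0).map x.toMonoidHom = N m 0 := hx 0
  have h1 : (N m 1).map x.toMonoidHom = N m 1 := hx 1
  have h2 : (N m 2).map x.toMonoidHom = (N m 2).map ρ.toMonoidHom := hx 2
  have h2' : (N m 2).map ρ.toMonoidHom ⊔ (⊥ : Subgroup (S m)) = (N m 2).map x.toMonoidHom ⊔ ⊥ := by
    rw [h2]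
  have key : tripleJoin m ρ ⊔ ⊥ = ⊤ := tripleJoin_sup_eq_top_of_carrier (ρ := ρ) (M := ⊥) h0 h1 h2'
  simpa using key

/-- **NECESSITY of C.**  The crux implies "no fine ghosts" at every `m` (so
`stub_limitsSimplyConnected` is not more false than the crux: a Kervaire–Higman flag in the fine
closure refutes both). -/
theorem tripleJoin_eq_top_of_crux (hC : HeegaardHandlebodyCongruenceClosed) (m : ℕ) (ρ : S m ≃* S m)
    (hρ : FineClosure m ρ) : tripleJoin m ρ = ⊤ :=
  tripleJoin_eq_top_of_inPQ (crux_iff.1 hC m ρ hρ)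

/-- In particular the crux implies `LimitsSimplyConnectedPos` verbatim. -/
theorem limitsSimplyConnectedPos_of_crux (hC : HeegaardHandlebodyCongruenceClosed) :
    LimitsSimplyConnectedPos :=
  fun m ρ hρ => tripleJoin_eq_top_of_crux hC (m + 1) ρ hρ

/-- **NECESSITY of D.**  The crux implies `FineApprox` verbatim, … -/
theorem fineApprox_of_crux (hC : HeegaardHandlebodyCongruenceClosed) : FineApprox :=
  fun m ρ hρ _ => iso_of_inPQ (crux_iff.1 hC m ρ hρ)

/-- … hence D₀ … -/
theorem fineApproxGenusThree_of_crux (hC : HeegaardHandlebodyCongruenceClosed) : FineApproxGenusThree :=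
  (fineApprox_iff.1 (fineApprox_of_crux hC)).1

/-- … and D₊. -/
theorem fineApproxPos_of_crux (hC : HeegaardHandlebodyCongruenceClosed) : FineApproxPos :=
  (fineApprox_iff.1 (fineApprox_of_crux hC)).2

end Summit.SmoothPoincare4.SmoothPoincare4.Cruxes.HeegaardHandlebodyCongruenceClosed.FineClosureCollapse

end
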